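import Summits.QuantumAdvantage.QuantumAdvantage.Theorems.NearExactIsExact.Negative.HyperplaneLeak
import Literature.Computability.QuantumComplexity.MSubspaceSignReadoutRelaxedRuns

/-!
# `NearExactIsExact` (stmt-QuantumAdvantage-14043) — negative-side structural lemma (disprove, gen 29):
  a LINEAR STRUCTURE on either side caps the forrelation at `√2/2`, uniformly in `n`

A pair `(a, ε) ∈ 𝔽₂ⁿ × 𝔽₂` with `a ≠ 0` is a *linear structure* of a Boolean function `g` when the derivative
`D_a g = g(· ⊕ a) ⊕ g` is the constant `ε` (Carlet's linear kernel; every partially-bent non-bent function,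
every function with a dummy variable, every quadratic form with a radical direction, every direct summand
placed on fewer than all the variables has one).  For ALL Boolean `f, g` on `n` bits (no degree hypothesis,
no parity hypothesis on `n`):

* `ls_twist_mul_W` / `ls_W_eq_zero`: `(-1)^{a·y} W_g(y) = (-1)^ε W_g(y)`, so the Walsh transform of `g` vanishes
  off the affine hyperplane `{y : a·y = ε}` (the forward half of [cite: Carlet2020, Prop. 29]);
* `ls_forrelation_sq_le_half`: **`Φ(f,g)² ≤ 1/2`** — write `2·Σ_z (-1)^{f z} W_g(z) = Σ_z φ(z) W_g(z)` with
  `φ = (-1)^f · (1 + (-1)^ε (-1)^{a·z}) ∈ {0, ±2}`, `Σ φ² = 2^{n+1}` (orthogonality `Σ_z (-1)^{a·z} = 0`), and apply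
  Cauchy–Schwarz with Parseval `Σ W_g² = 4ⁿ`;
* `ls_abs_forrelation_le` (**`|Φ(f,g)| ≤ √2/2`**), the mirror statements for a linear structure of `f`
  (`ls_forrelation_sq_le_half_left`, `ls_abs_forrelation_le_left`, by the symmetry of `Φ`, `MMReadout.forrelation_symm'`), `ls_forrelation_lt_one`,
  and the crux-facing reading `ls_isolation`: for every threshold `θ ≥ √2/2` a pair with a linear structure on
  either side satisfies `θ < Φ(f,g) → Φ(f,g) = 1` VACUOUSLY.

Consequence for the cell (DISPROOF.md §37): a family refuting `NearExactIsExact` — indeed any cubic pair with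
`Φ > √2/2 ≈ 0.7071`, in particular every pair above the decided thresholds `θ₈ = 13/16`, `θ₁₀ = 7/8` — has NO
linear structure on either side: both functions depend on all `n` variables, neither is partially bent (unless
bent), neither is a direct sum `h(x') ⊕ (affine)(x'')` with `x''` non-empty, and no quadratic side has a radical.
This is the degree-free, uniform-in-`n` companion of the coset-affine bound `|Φ|·|V| ≤ √(2ⁿ)` of
`Literature/…/ForrelationCosetAffineBound` (which is vacuous for `|V| = 2`).  HONEST FRAMING: a structural
constraint on near-exact pairs (value = theorem), NOT summit progress; it neither proves nor refutes
`NearExactIsExact`.  Standard axioms. [folklore]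
-/

set_option linter.dupNamespace false -- D-0017: single-problem summit ⇒ `QuantumAdvantage.QuantumAdvantage` by design

noncomputable section

namespace Summit.QuantumAdvantage.QuantumAdvantage.Theorems.NearExactIsExact.Negative.LinearStructure

open Finset
open Literature.Computability.QuantumComplexity
open Literature.Computability.QuantumComplexity.BuzetChailloux (bxor signOf_sq)
open Literature.Computability.QuantumComplexity.DerivativeWalsh (W sum_shift_twist sum_W_sq)
open Literature.Computability.QuantumComplexity.Simon (twist_sq sum_twist)
open Literature.Computability.QuantumComplexity.MMReadout (forrelation_symm')
open Summit.QuantumAdvantage.QuantumAdvantage.Theorems.NearExactIsExact.Negative.HyperplaneLeak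
  (hl_sum_signOf_mul_W)

variable {n : ℕ}

/-! ### Walsh support of a function with a linear structure -/

/-- If `g (a ⊕ x) = g x ⊕ ε` for all `x`, then `(-1)^{a·y} W_g(y) = (-1)^ε W_g(y)` for every `y`.
[cite: Carlet2020, Prop. 29] -/
theorem ls_twist_mul_W (g : (Fin n → Bool) → Bool) {a : Fin n → Bool} {ε : Bool}
    (hg : ∀ x, g (bxor a x) = (g x ^^ ε)) (y : Fin n → Bool) :
    twist a y * W (fun x => signOf (g x)) y = signOf ε * W (fun x => signOf (g x)) y := by
  rw [← sum_shift_twist (fun x => signOf (g x)) a y]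
  simp only [hg, signOf_xor]
  rw [W, mul_sum]
  exact sum_congr rfl fun x _ => by ring

/-- **Walsh support in a hyperplane.** If `g (a ⊕ x) = g x ⊕ ε` for all `x`, then `W_g(y) = 0` at every `y`
with `(-1)^{a·y} ≠ (-1)^ε`, i.e. off the affine hyperplane `{a·y = ε}`. [cite: Carlet2020, Prop. 29] -/
theorem ls_W_eq_zero (g : (Fin n → Bool) → Bool) {a : Fin n → Bool} {ε : Bool}
    (hg : ∀ x, g (bxor a x) = (g x ^^ ε)) {y : Fin n → Bool} (hy : twist a y ≠ signOf ε) :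
    W (fun x => signOf (g x)) y = 0 := by
  have h := ls_twist_mul_W g hg y
  have h' : (twist a y - signOf ε) * W (fun x => signOf (g x)) y = 0 := by rw [sub_mul, h, sub_self]
  rcases mul_eq_zero.1 h' with h1 | h1
  · exact absurd (sub_eq_zero.1 h1) hy
  · exact h1

/-- The projector form: `2 W_g(y) = (1 + (-1)^ε (-1)^{a·y}) W_g(y)`. [folklore] -/
theorem ls_two_mul_W (g : (Fin n → Bool) → Bool) {a : Fin n → Bool} {ε : Bool}
    (hg : ∀ x, g (bxor a x) = (g x ^^ ε)) (y : Fin n → Bool) :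
    2 * W (fun x => signOf (g x)) y = (1 + signOf ε * twist a y) * W (fun x => signOf (g x)) y := by
  have h := ls_twist_mul_W g hg y
  have hε : signOf ε * signOf ε = 1 := by rw [← sq, signOf_sq]
  have h2 : signOf ε * (twist a y * W (fun x => signOf (g x)) y) = W (fun x => signOf (g x)) y := by
    rw [h, ← mul_assoc, hε, one_mul]
  linear_combination (-1 : ℝ) * h2

/-! ### The cap `Φ² ≤ 1/2` -/

/-- `Σ_z ((-1)^{f z} (1 + (-1)^ε (-1)^{a·z}))² = 2^{n+1}` for `a ≠ 0`. [folklore] -/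
theorem ls_sum_phi_sq (f : (Fin n → Bool) → Bool) {a : Fin n → Bool} (ha : a ≠ fun _ => false) (ε : Bool) :
    ∑ z : Fin n → Bool, (signOf (f z) * (1 + signOf ε * twist a z)) ^ 2 = (2 : ℝ) ^ (n + 1) := by
  have e : ∀ z : Fin n → Bool,
      (signOf (f z) * (1 + signOf ε * twist a z)) ^ 2 = 2 + 2 * signOf ε * twist a z := by
    intro z
    have h1 : signOf (f z) ^ 2 = 1 := signOf_sq _
    have h2 : signOf ε ^ 2 = 1 := signOf_sq _
    have h3 : twist a z ^ 2 = 1 := twist_sq _ _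
    linear_combination (1 + signOf ε * twist a z) ^ 2 * h1 + twist a z ^ 2 * h2 + h3
  simp_rw [e]
  rw [sum_add_distrib, ← mul_sum, sum_twist a, if_neg ha, mul_zero, add_zero, sum_const, card_univ,
    Fintype.card_fun, Fintype.card_bool, Fintype.card_fin]
  simp [pow_succ, mul_comm]

/-- Parseval for `±1` data: `Σ_y W_g(y)² = 2ⁿ·2ⁿ`. [cite: ODonnell2014, §1.4] -/
theorem ls_sum_W_sq (g : (Fin n → Bool) → Bool) :
    ∑ y, W (fun x => signOf (g x)) y ^ 2 = (2 : ℝ) ^ n * (2 : ℝ) ^ n := by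
  rw [sum_W_sq]
  simp_rw [signOf_sq]
  rw [sum_const, card_univ, Fintype.card_fun, Fintype.card_bool, Fintype.card_fin]
  simp

/-- **Linear structure ⇒ `Φ² ≤ 1/2`.**  For ALL Boolean `f, g` on `n` bits: if `g (a ⊕ x) = g x ⊕ ε` for all
`x` with `a ≠ 0`, then `Φ(f,g)² ≤ 1/2`. [folklore] -/
theorem ls_forrelation_sq_le_half (f g : (Fin n → Bool) → Bool) {a : Fin n → Bool} {ε : Bool}
    (ha : a ≠ fun _ => false) (hg : ∀ x, g (bxor a x) = (g x ^^ ε)) :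
    forrelation f g ^ 2 ≤ 1 / 2 := by
  have hS := hl_sum_signOf_mul_W f g
  have h2 : 2 * ∑ z, signOf (f z) * W (fun y => signOf (g y)) z =
      ∑ z, (signOf (f z) * (1 + signOf ε * twist a z)) * W (fun y => signOf (g y)) z := by
    rw [mul_sum]
    refine sum_congr rfl fun z _ => ?_
    have h := ls_two_mul_W g hg z
    linear_combination signOf (f z) * h
  have hCS := sum_mul_sq_le_sq_mul_sq (univ : Finset (Fin n → Bool))
    (fun z => signOf (f z) * (1 + signOf ε * twist a z)) (fun z => W (fun y => signOf (g y)) z)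
  rw [← h2, ls_sum_phi_sq f ha ε, ls_sum_W_sq, hS] at hCS
  have hK : Real.sqrt ((2 : ℝ) ^ n) ^ 2 = (2 : ℝ) ^ n := Real.sq_sqrt (by positivity)
  have hN : (0 : ℝ) < (2 : ℝ) ^ n := by positivity
  have h3 : 0 < ((2 : ℝ) ^ n) ^ 3 := by positivity
  -- `hCS : (2 * (2^n * √(2^n) * Φ))² ≤ 2^{n+1} * (2^n * 2^n)`
  have h4 : ((2 : ℝ) ^ n) ^ 3 * (4 * forrelation f g ^ 2) ≤ ((2 : ℝ) ^ n) ^ 3 * 2 := by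
    have e1 : (2 * ((2 : ℝ) ^ n * Real.sqrt ((2 : ℝ) ^ n) * forrelation f g)) ^ 2 =
        ((2 : ℝ) ^ n) ^ 3 * (4 * forrelation f g ^ 2) := by
      rw [show (2 * ((2 : ℝ) ^ n * Real.sqrt ((2 : ℝ) ^ n) * forrelation f g)) ^ 2 =
        4 * ((2 : ℝ) ^ n) ^ 2 * Real.sqrt ((2 : ℝ) ^ n) ^ 2 * forrelation f g ^ 2 by ring, hK]
      ring
    have e2 : (2 : ℝ) ^ (n + 1) * ((2 : ℝ) ^ n * (2 : ℝ) ^ n) = ((2 : ℝ) ^ n) ^ 3 * 2 := by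
      rw [pow_succ]; ring
    rw [← e1, ← e2]
    exact hCS
  have h5 := le_of_mul_le_mul_left h4 h3
  linarith

/-- **Linear structure on `g` ⇒ `|Φ(f,g)| ≤ √2/2`** (all `f`, all `n`). [folklore] -/
theorem ls_abs_forrelation_le (f g : (Fin n → Bool) → Bool) {a : Fin n → Bool} {ε : Bool}
    (ha : a ≠ fun _ => false) (hg : ∀ x, g (bxor a x) = (g x ^^ ε)) :
    |forrelation f g| ≤ Real.sqrt 2 / 2 := by
  have hhalf : Real.sqrt (1 / 2) = Real.sqrt 2 / 2 := by
    rw [show (1 : ℝ) / 2 = 2 / 4 by norm_num, Real.sqrt_div' 2 (by norm_num : (0 : ℝ) ≤ 4),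
      show (4 : ℝ) = 2 ^ 2 by norm_num, Real.sqrt_sq (by norm_num : (0 : ℝ) ≤ 2)]
  rw [← hhalf, ← Real.sqrt_sq_eq_abs]
  exact Real.sqrt_le_sqrt (ls_forrelation_sq_le_half f g ha hg)

/-- **Linear structure on `f` ⇒ `Φ(f,g)² ≤ 1/2`** (all `g`, all `n`). [folklore] -/
theorem ls_forrelation_sq_le_half_left (f g : (Fin n → Bool) → Bool) {a : Fin n → Bool} {ε : Bool}
    (ha : a ≠ fun _ => false) (hf : ∀ x, f (bxor a x) = (f x ^^ ε)) :
    forrelation f g ^ 2 ≤ 1 / 2 := by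
  rw [← forrelation_symm']
  exact ls_forrelation_sq_le_half g f ha hf

/-- **Linear structure on `f` ⇒ `|Φ(f,g)| ≤ √2/2`** (all `g`, all `n`). [folklore] -/
theorem ls_abs_forrelation_le_left (f g : (Fin n → Bool) → Bool) {a : Fin n → Bool} {ε : Bool}
    (ha : a ≠ fun _ => false) (hf : ∀ x, f (bxor a x) = (f x ^^ ε)) :
    |forrelation f g| ≤ Real.sqrt 2 / 2 := by
  rw [← forrelation_symm']
  exact ls_abs_forrelation_le g f ha hf

/-- In particular a pair with a linear structure on `g` is never exact: `Φ(f,g) < 1`. [folklore] -/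
theorem ls_forrelation_lt_one (f g : (Fin n → Bool) → Bool) {a : Fin n → Bool} {ε : Bool}
    (ha : a ≠ fun _ => false) (hg : ∀ x, g (bxor a x) = (g x ^^ ε)) :
    forrelation f g < 1 := by
  have h := ls_forrelation_sq_le_half f g ha hg
  nlinarith

/-- Translation INVARIANCE (`ε = 0`, e.g. a dummy variable: `a = eᵢ`) is the special case
`g (a ⊕ x) = g x`: then `|Φ(f,g)| ≤ √2/2` for every `f`. [folklore] -/
theorem ls_abs_forrelation_le_of_invariant (f g : (Fin n → Bool) → Bool) {a : Fin n → Bool}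
    (ha : a ≠ fun _ => false) (hg : ∀ x, g (bxor a x) = g x) :
    |forrelation f g| ≤ Real.sqrt 2 / 2 :=
  ls_abs_forrelation_le f g ha (ε := false) (fun x => by rw [hg x, Bool.xor_false])

/-- **Crux-facing reading.** For every threshold `θ ≥ √2/2` (in particular every `θ ≥ 3/4`), a pair whose `g`
has a linear structure satisfies the isolation implication `θ < Φ(f,g) → Φ(f,g) = 1` of `NearExactIsExact`
vacuously — such pairs can never witness its negation. [folklore] -/
theorem ls_isolation (f g : (Fin n → Bool) → Bool) {a : Fin n → Bool} {ε : Bool} {θ : ℝ}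
    (hθ : Real.sqrt 2 / 2 ≤ θ) (ha : a ≠ fun _ => false) (hg : ∀ x, g (bxor a x) = (g x ^^ ε)) :
    θ < forrelation f g → forrelation f g = 1 := by
  intro hlt
  have h := ls_abs_forrelation_le f g ha hg
  have h' := le_abs_self (forrelation f g)
  linarith

/-- The same on the `f` side. [folklore] -/
theorem ls_isolation_left (f g : (Fin n → Bool) → Bool) {a : Fin n → Bool} {ε : Bool} {θ : ℝ}
    (hθ : Real.sqrt 2 / 2 ≤ θ) (ha : a ≠ fun _ => false) (hf : ∀ x, f (bxor a x) = (f x ^^ ε)) :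
    θ < forrelation f g → forrelation f g = 1 := by
  intro hlt
  have h := ls_abs_forrelation_le_left f g ha hf
  have h' := le_abs_self (forrelation f g)
  linarith

end Summit.QuantumAdvantage.QuantumAdvantage.Theorems.NearExactIsExact.Negative.LinearStructure
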